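import Summits.AtomisticToContinuum.HydrodynamicLimit.Theorems.OneSphereInfluencePreShockHomotopy
import Literature.Analysis.PDE.SymmHyperbolicLocalExistenceDimAll
import HarnessLib

/-!
# `OneSphereInfluence.PreShockHomotopy` (stmt-AtomisticToContinuum-13621) — PROVED

The one-liner announced in `OneSphereInfluencePreShockHomotopy.lean` («becomes
`preShockHomotopy_holds` the day `SymmHyperbolicLocalExistenceDim 4` is proved in the tree»):
the route decl `Theses.OneSphereInfluence.PreShockHomotopy` of the sub-problem
`Summit.AtomisticToContinuum.HydrodynamicLimit` follows from the door of record
`PreShockDoor.preShockHomotopy_of_dim4` and the tree theorem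
`Literature.Analysis.PDE.symmHyperbolicLocalExistenceDim_four` (`[X₄]`; decomp-a2c lens-1
g43–g49, ParameterAsDimension line G0–G6: `WordSupEmbedding` → Moser/commutator → a priori →
scheme → limit → local existence on `𝕋ᵈ` → `[X_d]` for every `d` → door). No hypothesis and no
named fact as input; the H21 audit label of this file is unconditional (`closes` by name).
Nothing else about the summit is claimed.
-/

namespace Summit.AtomisticToContinuum.HydrodynamicLimit.Theorems.PreShockDoor

/-- **`PreShockHomotopy` (stmt-AtomisticToContinuum-13621) HOLDS** — unconditionally: the door
of record `preShockHomotopy_of_dim4` (`[S]`, `[E]`, `[I]` theorems of the tree, `[U]` =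
`hsEuler_uniqueness_smallPacking`, `[WD]` from `symmHyperbolic_smoothFamilies` by the
ParameterAsDimension door) applied to the tree theorem `[X₄]`
`Literature.Analysis.PDE.symmHyperbolicLocalExistenceDim_four : SymmHyperbolicLocalExistenceDim 4`
(single-datum smooth local existence for quasilinear symmetric hyperbolic systems on `𝕋⁴`:
Majda's energy method re-typed on `𝕋ᵈ` for every `d` — `TorusQuasilinearAPriori/Scheme/Limit`,
`TorusSymmHyperbolicLocalExistence`, `SymmHyperbolicLocalExistenceDimAll`). Nothing about the
summit `AtomisticToContinuum` beyond this route statement is claimed.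
[cite: Kato1975, Thms II–III] [cite: Majda1984, Ch. 2 §2.1, Thm 2.1]
[cite: Dafermos2005, Thm 5.1.1] -/
theorem preShockHomotopy_holds :
    Summit.AtomisticToContinuum.HydrodynamicLimit.Theses.OneSphereInfluence.PreShockHomotopy :=
  preShockHomotopy_of_dim4 Literature.Analysis.PDE.symmHyperbolicLocalExistenceDim_four

end Summit.AtomisticToContinuum.HydrodynamicLimit.Theorems.PreShockDoor
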